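import Summits.PneNP.PneNP.Theorems.ConvexRankGatesConvexGateBlindExactLiftingAnchoredMixedCore

/-!
# `ExactLifting`: the mixed junta × anchor cell — kernel averaging, positivity and the flip lemma

Support file for crux `ConvexGateBlind` (stmt-PneNP-10680), line `xor-door-perfect-completeness`, open stub
`stub_exactLifting` (prover seat 0, session 18; second of three files: `…AnchoredMixedCore` ⟵ this ⟵ `…AnchoredMixedMain`;
memo ANALYSIS9 §3).

For an XOR instance `A : V → Finset (Fin m)`, `c : V → 𝔽₂` under Grigoriev's isoperimetric hypotheses `IsoHyp A 1 d` this file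
supplies the two analytic ingredients of the exclusion of mixed one-sided-junta + anchor factorisations:

* §1–§2 POSITIVITY OF THE DETERMINED PART. `exists_bd_eq_of_ker`: a parity vanishing on the kernel
  `K = {k : every homogeneous equation holds}` is a boundary (row space = annihilator of the kernel over `𝔽₂`,
  `mem_span_of_iInf_ker_le_ker`); with isoperimetry a character of `≤ d` variables trivial on `K` is determined
  (`IsoHyp.det_of_chi_kerSet`); character sums over `K` (`sum_kerSet_chi`); hence `∑_{k∈K} γ(z+k) = #K · detPart γ z`
  (`IsoHyp.sum_kerSet_translate`) and `detPart γ z > 0` for `γ > 0` of degree `≤ d` (`IsoHyp.detPart_pos`).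
* §3 THE FLIP. `Ẽ[γ(z+·)] = ∑_S e(S) γ̂(S) χ_S(z)` (`func_translate_eq`); for a point `q` realising the charge vector flipped
  at `v`, `detPart γ (z+q) = Ẽ[γ(z+·)] − 2 e(A v) γ̂(A v) χ_{A v}(z)` (`IsoHyp.detPart_flip`); so two points with
  `Ẽ[γ(z+·)] < 0` agree on every `χ_{A v}` (`IsoHyp.bad_agree`, registered form `mixed_bad_agree`); `χ_{∂x} = ∏_{v∈x} χ_{A v}`
  (`chi_bd`).
-/

set_option linter.dupNamespace false -- `Summit.PneNP.PneNP.…`: summit = sub-problem (D-0017)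

namespace Summit.PneNP.PneNP.Theorems.XorDoor.PC

open Finset

noncomputable section

variable {m : ℕ} {V : Type} [Fintype V] [DecidableEq V]

/-! ## §1 A parity vanishing on the kernel of the instance is a boundary -/

/-- The parity `k ↦ ∑_{i ∈ T} k i` as an `𝔽₂`-linear form. -/
def parityForm (T : Finset (Fin m)) : (Fin m → ZMod 2) →ₗ[ZMod 2] ZMod 2 where
  toFun k := ∑ i ∈ T, k i
  map_add' k k' := by simp [Finset.sum_add_distrib]
  map_smul' a k := by simp [Finset.mul_sum]

omit [Fintype V] [DecidableEq V] in
/-- `parityForm T (e_i) = [i ∈ T]`. -/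
theorem parityForm_single (T : Finset (Fin m)) (i : Fin m) :
    parityForm T (Pi.single i 1) = if i ∈ T then 1 else 0 := by
  show ∑ j ∈ T, (Pi.single i (1 : ZMod 2) : Fin m → ZMod 2) j = _
  rw [Finset.sum_pi_single']

omit [DecidableEq V] in
/-- **Duality.** If the parity on `S` vanishes on every `k` satisfying all homogeneous equations, then `S` is the
boundary of a set of equations (row space = annihilator of the kernel, over `𝔽₂`). -/
theorem exists_bd_eq_of_ker (A : V → Finset (Fin m)) (S : Finset (Fin m))
    (hS : ∀ k : Fin m → ZMod 2, (∀ v, ∑ i ∈ A v, k i = 0) → ∑ i ∈ S, k i = 0) :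
    ∃ X : Finset V, bd A X = S := by
  classical
  have hker : ⨅ v, LinearMap.ker (parityForm (A v)) ≤ LinearMap.ker (parityForm S) := by
    intro k hk
    rw [Submodule.mem_iInf] at hk
    exact hS k fun v => hk v
  obtain ⟨a, ha⟩ :=
    (Submodule.mem_span_range_iff_exists_fun (ZMod 2)).mp (mem_span_of_iInf_ker_le_ker hker)
  refine ⟨univ.filter fun v => a v = 1, ?_⟩
  ext i
  have hi := LinearMap.congr_fun ha (Pi.single i 1)
  simp only [LinearMap.coe_sum, Finset.sum_apply, LinearMap.smul_apply, parityForm_single,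
    smul_eq_mul] at hi
  rw [mem_bd, bsum]
  have hb : ∑ v ∈ univ.filter (fun v => a v = 1), (if i ∈ A v then (1 : ZMod 2) else 0) =
      ∑ v, a v * (if i ∈ A v then (1 : ZMod 2) else 0) := by
    rw [Finset.sum_filter]
    refine Finset.sum_congr rfl fun v _ => ?_
    rcases eq_zero_or_eq_one (a v) with h | h <;> simp [h]
  rw [hb, hi]
  by_cases hiS : i ∈ S <;> simp [hiS]

/-! ## §2 The kernel, character sums over it, and positivity of the determined part -/

/-- The kernel of the instance: assignments satisfying every HOMOGENEOUS equation. -/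
def kerSet (A : V → Finset (Fin m)) : Finset (Fin m → ZMod 2) :=
  univ.filter fun k => ∀ v, ∑ i ∈ A v, k i = 0

omit [DecidableEq V] in
/-- `0 ∈ K`. -/
theorem zero_mem_kerSet (A : V → Finset (Fin m)) : (0 : Fin m → ZMod 2) ∈ kerSet A := by
  simp [kerSet]

omit [DecidableEq V] in
/-- `K` is closed under addition. -/
theorem add_mem_kerSet {A : V → Finset (Fin m)} {k k' : Fin m → ZMod 2} (hk : k ∈ kerSet A)
    (hk' : k' ∈ kerSet A) : k + k' ∈ kerSet A := by
  simp only [kerSet, mem_filter, mem_univ, true_and] at hk hk' ⊢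
  intro v
  simp only [Pi.add_apply, Finset.sum_add_distrib, hk v, hk' v, add_zero]

omit [DecidableEq V] in
/-- **Character sums over the kernel**: `∑_{k ∈ K} χ_S(k)` is `#K` if `χ_S ≡ 1` on `K` and `0` otherwise
(translate by a kernel element on which `χ_S = −1`). -/
theorem sum_kerSet_chi (A : V → Finset (Fin m)) (S : Finset (Fin m)) :
    ∑ k ∈ kerSet A, chi S k =
      if ∀ k ∈ kerSet A, chi S k = 1 then ((kerSet A).card : ℝ) else 0 := by
  split_ifs with hall
  · rw [Finset.sum_congr rfl hall, Finset.sum_const, nsmul_eq_mul, mul_one]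
  · push Not at hall
    obtain ⟨k₀, hk₀, hk₀'⟩ := hall
    have hneg : chi S k₀ = -1 := (chi_eq_one_or S k₀).resolve_left hk₀'
    have hbij : ∑ k ∈ kerSet A, chi S k = ∑ k ∈ kerSet A, chi S (k + k₀) := by
      refine Finset.sum_nbij' (fun k => k + k₀) (fun k => k + k₀) (fun k hk => add_mem_kerSet hk hk₀)
        (fun k hk => add_mem_kerSet hk hk₀) (fun k _ => ?_) (fun k _ => ?_) (fun k _ => ?_)
      · funext i; simp only [Pi.add_apply]; rw [add_assoc, CharTwo.add_self_eq_zero, add_zero]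
      · funext i; simp only [Pi.add_apply]; rw [add_assoc, CharTwo.add_self_eq_zero, add_zero]
      · rw [add_assoc, show k₀ + k₀ = 0 from by
          funext i; simp only [Pi.add_apply, Pi.zero_apply]; exact CharTwo.add_self_eq_zero _, add_zero]
    have h2 : ∑ k ∈ kerSet A, chi S (k + k₀) = -∑ k ∈ kerSet A, chi S k := by
      rw [← Finset.sum_neg_distrib]
      refine Finset.sum_congr rfl fun k _ => ?_
      rw [chi_add, hneg]; ring
    linarith

/-- Under the isoperimetric hypotheses (and every variable in an even number of equations), a set of at most `d`
variables whose character is `≡ 1` on the kernel is determined (`∅` or an equation). -/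
theorem IsoHyp.det_of_chi_kerSet {A : V → Finset (Fin m)} {d : ℕ} (h : IsoHyp A 1 d) (hdeg : bd A univ = ∅)
    {S : Finset (Fin m)} (hS : S.card ≤ d) (hone : ∀ k ∈ kerSet A, chi S k = 1) : Det A 1 S := by
  classical
  have hpar : ∀ k : Fin m → ZMod 2, (∀ v, ∑ i ∈ A v, k i = 0) → ∑ i ∈ S, k i = 0 := by
    intro k hk
    have h1 := hone k (by simp only [kerSet, mem_filter, mem_univ, true_and]; exact hk)
    rw [chi_eq_sgn_sum] at h1
    rw [← sgn_eq_sgn_iff, h1, sgn_zero]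
  obtain ⟨X, hX⟩ := exists_bd_eq_of_ker A S hpar
  rcases h.iso X (by rw [hX]; exact hS) with hsmall | hbig
  · exact ⟨X, hsmall, hX⟩
  · -- co-small: `∂X = ∂(univ ∆ X)` since `∂ univ = ∅`
    refine ⟨univ \ X, ?_, ?_⟩
    · have := Finset.card_univ_sdiff X
      omega
    · have hsd : univ \ X = symmDiff univ X := by
        ext v; simp [mem_symmDiff]
      rw [hsd, bd_symmDiff, hdeg, hX]
      simp

omit [DecidableEq V] in
/-- The kernel makes every equation's character trivial: `χ_{A v} ≡ 1` on `K`; hence so is `χ_S` for determined `S`. -/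
theorem chi_kerSet_of_det {A : V → Finset (Fin m)} {S : Finset (Fin m)} (hS : Det A 1 S) :
    ∀ k ∈ kerSet A, chi S k = 1 := by
  intro k hk
  obtain ⟨T, hT, rfl⟩ := hS
  simp only [kerSet, mem_filter, mem_univ, true_and] at hk
  rcases Nat.le_one_iff_eq_zero_or_eq_one.mp hT with h0 | h1
  · rw [Finset.card_eq_zero.mp h0, bd_empty, chi_empty]
  · obtain ⟨v, rfl⟩ := Finset.card_eq_one.mp h1
    rw [bd_singleton, chi_eq_sgn_sum, hk v, sgn_zero]

open scoped Classical in
/-- The DETERMINED PART of `γ` at `z`: `∑_{S determined} γ̂(S) χ_S(z)`. -/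
def detPart (A : V → Finset (Fin m)) (γ : (Fin m → ZMod 2) → ℝ) (z : Fin m → ZMod 2) : ℝ :=
  ∑ S : Finset (Fin m), if Det A 1 S then coeff γ S * chi S z else 0

/-- **Averaging identity**: `∑_{k ∈ K} γ(z + k) = #K · detPart γ z` for `γ` of degree `≤ d`. -/
theorem IsoHyp.sum_kerSet_translate {A : V → Finset (Fin m)} {d : ℕ} (h : IsoHyp A 1 d) (hdeg : bd A univ = ∅)
    {γ : (Fin m → ZMod 2) → ℝ} (hγ : ∀ S : Finset (Fin m), d < S.card → coeff γ S = 0) (z : Fin m → ZMod 2) :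
    ∑ k ∈ kerSet A, γ (z + k) = (kerSet A).card * detPart A γ z := by
  classical
  have hexp : ∀ k, γ (z + k) = ∑ S, coeff γ S * (chi S z * chi S k) := fun k => by
    conv_lhs => rw [eq_sum_coeff_smul_chi γ]
    simp only [Finset.sum_apply, Pi.smul_apply, smul_eq_mul, chi_add]
  simp_rw [hexp]
  rw [Finset.sum_comm, detPart, Finset.mul_sum]
  refine Finset.sum_congr rfl fun S _ => ?_
  have hfac : ∑ k ∈ kerSet A, coeff γ S * (chi S z * chi S k) =
      coeff γ S * chi S z * ∑ k ∈ kerSet A, chi S k := by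
    rw [Finset.mul_sum]
    exact Finset.sum_congr rfl fun k _ => by ring
  rw [hfac, sum_kerSet_chi]
  by_cases hdet : Det A 1 S
  · rw [if_pos (chi_kerSet_of_det hdet), if_pos hdet]; ring
  · rw [if_neg hdet, mul_zero]
    by_cases hS : d < S.card
    · rw [hγ S hS]; simp
    · rw [if_neg fun hone => hdet (h.det_of_chi_kerSet hdeg (not_lt.mp hS) hone)]; simp

/-- **Positivity of the determined part**: for `γ > 0` of degree `≤ d`, `detPart γ z > 0` at every `z`
(it is the average of `γ` over the coset `z + K`). -/
theorem IsoHyp.detPart_pos {A : V → Finset (Fin m)} {d : ℕ} (h : IsoHyp A 1 d) (hdeg : bd A univ = ∅)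
    {γ : (Fin m → ZMod 2) → ℝ} (hγ : ∀ S : Finset (Fin m), d < S.card → coeff γ S = 0)
    (hpos : ∀ u, 0 < γ u) (z : Fin m → ZMod 2) : 0 < detPart A γ z := by
  have hsum : 0 < ∑ k ∈ kerSet A, γ (z + k) :=
    Finset.sum_pos (fun k _ => hpos _) ⟨0, zero_mem_kerSet A⟩
  rw [h.sum_kerSet_translate hdeg hγ z] at hsum
  have hcard : (0 : ℝ) < (kerSet A).card := by exact_mod_cast Finset.card_pos.mpr ⟨0, zero_mem_kerSet A⟩
  exact pos_of_mul_pos_right hsum hcard.le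

/-! ## §3 The signed determined part `γ̌ = Ẽ[γ(z+·)]` and the flip -/

omit [Fintype V] [DecidableEq V] in
/-- `Ẽ[γ(z + ·)] = ∑_S e(S) γ̂(S) χ_S(z)`. -/
theorem func_translate_eq (A : V → Finset (Fin m)) (c : V → ZMod 2) (γ : (Fin m → ZMod 2) → ℝ)
    (z : Fin m → ZMod 2) : func A c 1 (fun u => γ (z + u)) = ∑ S, e A c 1 S * (coeff γ S * chi S z) := by
  rw [func_apply]
  refine Finset.sum_congr rfl fun S _ => ?_
  rw [coeff_translate]; ring

/-- **The flip identity.** If `q` realises the charge vector flipped at `v` (`∑_{A w} q = c w + [w = v]`), then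
`detPart γ (z + q) = Ẽ[γ(z+·)] − 2 · e(A v) γ̂(A v) χ_{A v}(z)` (equations pairwise distinct, `#V > 1`). -/
theorem IsoHyp.detPart_flip {A : V → Finset (Fin m)} {d : ℕ} (h : IsoHyp A 1 d) (c : V → ZMod 2)
    (hinj : Function.Injective A) (γ : (Fin m → ZMod 2) → ℝ) (z : Fin m → ZMod 2) (v : V)
    (q : Fin m → ZMod 2) (hq : ∀ w, ∑ i ∈ A w, q i = c w + if w = v then 1 else 0) :
    detPart A γ (z + q) =
      func A c 1 (fun u => γ (z + u)) - 2 * (e A c 1 (A v) * (coeff γ (A v) * chi (A v) z)) := by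
  classical
  rw [func_translate_eq, detPart]
  -- compare termwise: the difference is concentrated on `S = A v`
  have hAne : ∀ w, A w ≠ ∅ := fun w hw => by
    rcases h.conn {w} (by rw [bd_singleton, hw]) with h0 | h1
    · exact absurd h0 (Finset.singleton_ne_empty w)
    · have := h.three_mul_lt
      have h2 : Fintype.card V = 1 := by rw [← Finset.card_univ, ← h1, Finset.card_singleton]
      omega
  have hterm : ∀ S : Finset (Fin m), (if Det A 1 S then coeff γ S * chi S (z + q) else 0) =
      e A c 1 S * (coeff γ S * chi S z) -
        (if S = A v then 2 * (e A c 1 (A v) * (coeff γ (A v) * chi (A v) z)) else 0) := by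
    intro S
    by_cases hdet : Det A 1 S
    · obtain ⟨T, hT, rfl⟩ := hdet
      rw [if_pos ⟨T, hT, rfl⟩, chi_add]
      rcases Nat.le_one_iff_eq_zero_or_eq_one.mp hT with h0 | h1
      · rw [Finset.card_eq_zero.mp h0, bd_empty, h.e_empty, if_neg (fun he => hAne v he.symm)]
        simp
      · obtain ⟨w, rfl⟩ := Finset.card_eq_one.mp h1
        rw [bd_singleton, h.e_apply_eq, chi_eq_sgn_sum (A w) q, hq w, sgn_add]
        by_cases hwv : w = v
        · subst hwv
          rw [if_pos rfl, if_pos rfl, sgn_one, h.e_apply_eq]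
          ring
        · rw [if_neg hwv, if_neg (fun hE => hwv (hinj hE)), sgn_zero]
          ring
    · rw [if_neg hdet, e_eq_zero hdet, if_neg]
      · ring
      · rintro rfl
        exact hdet ⟨{v}, by simp, bd_singleton A v⟩
  simp_rw [hterm]
  rw [Finset.sum_sub_distrib, Finset.sum_ite_eq' univ (A v), if_pos (mem_univ _)]

/-- **Bad points agree on every equation character.** If every even syndrome is realisable and the total charge is
odd, then for `γ > 0` of degree `≤ d`, any two points with `Ẽ[γ(z+·)] < 0` have the same `χ_{A v}` for every `v`. -/
theorem IsoHyp.bad_agree {A : V → Finset (Fin m)} {d : ℕ} (h : IsoHyp A 1 d) (hdeg : bd A univ = ∅) (c : V → ZMod 2)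
    (hinj : Function.Injective A) (hodd : ∑ v, c v = 1)
    (hsurj : ∀ σ : V → ZMod 2, ∑ v, σ v = 0 → ∃ q : Fin m → ZMod 2, ∀ v, ∑ i ∈ A v, q i = σ v)
    {γ : (Fin m → ZMod 2) → ℝ} (hγ : ∀ S : Finset (Fin m), d < S.card → coeff γ S = 0) (hpos : ∀ u, 0 < γ u)
    {z z' : Fin m → ZMod 2} (hz : func A c 1 (fun u => γ (z + u)) < 0)
    (hz' : func A c 1 (fun u => γ (z' + u)) < 0) (v : V) : chi (A v) z = chi (A v) z' := by
  classical
  -- the flipped charge vector at `v` is even, hence realisable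
  obtain ⟨q, hq⟩ := hsurj (fun w => c w + if w = v then 1 else 0) (by
    rw [Finset.sum_add_distrib, hodd, Finset.sum_ite_eq' univ v, if_pos (mem_univ _)]
    decide)
  have hτ : ∀ y : Fin m → ZMod 2, func A c 1 (fun u => γ (y + u)) < 0 →
      e A c 1 (A v) * (coeff γ (A v) * chi (A v) y) < 0 := by
    intro y hy
    have hflip := h.detPart_flip c hinj γ y v q hq
    have hp := h.detPart_pos hdeg hγ hpos (y + q)
    linarith
  have h1 := hτ z hz
  have h2 := hτ z' hz'
  by_contra hne
  have hflip : chi (A v) z' = -chi (A v) z := by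
    rcases chi_eq_one_or (A v) z with ha | ha <;> rcases chi_eq_one_or (A v) z' with hb | hb
    · exact absurd (ha.trans hb.symm) hne
    · rw [ha, hb]
    · rw [ha, hb]; norm_num
    · exact absurd (ha.trans hb.symm) hne
  rw [hflip] at h2
  have h3 : e A c 1 (A v) * (coeff γ (A v) * -chi (A v) z) =
      -(e A c 1 (A v) * (coeff γ (A v) * chi (A v) z)) := by ring
  linarith

omit [Fintype V] in
/-- `χ_{∂x} = ∏_{v ∈ x} χ_{A v}`. -/
theorem chi_bd (A : V → Finset (Fin m)) (x : Finset V) (z : Fin m → ZMod 2) :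
    chi (bd A x) z = ∏ v ∈ x, chi (A v) z := by
  classical
  induction x using Finset.induction_on with
  | empty => simp
  | insert a s ha ih =>
    have hins : insert a s = symmDiff {a} s := by
      ext w
      simp only [mem_insert, mem_symmDiff, mem_singleton]
      constructor
      · rintro (rfl | hw)
        · exact Or.inl ⟨rfl, ha⟩
        · exact Or.inr ⟨hw, fun h => ha (h ▸ hw)⟩
      · rintro (⟨rfl, -⟩ | ⟨hw, -⟩)
        · exact Or.inl rfl
        · exact Or.inr hw
    rw [Finset.prod_insert ha, hins, bd_symmDiff, bd_singleton, ← chi_mul_chi, ih]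

/-- **Bad points agree on every equation character** — registered sub-goal `mixed_bad_agree` of stmt-PneNP-10680, verbatim
signature (see `IsoHyp.bad_agree`). -/
theorem mixed_bad_agree :
    ∀ {m : ℕ} {V : Type} [Fintype V] [DecidableEq V] {A : V → Finset (Fin m)} {d : ℕ}, IsoHyp A 1 d → bd A
    Finset.univ = ∅ → ∀ (c : V → ZMod 2), Function.Injective A → ∑ v, c v = 1 → (∀ σ : V → ZMod 2, ∑ v, σ v = 0
    → ∃ q : Fin m → ZMod 2, ∀ v, ∑ i ∈ A v, q i = σ v) → ∀ {γ : (Fin m → ZMod 2) → ℝ}, (∀ S : Finset (Fin m), d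
    < S.card → coeff γ S = 0) → (∀ u, 0 < γ u) → ∀ {z z' : Fin m → ZMod 2}, func A c 1 (fun u => γ (z + u)) < 0
    → func A c 1 (fun u => γ (z' + u)) < 0 → ∀ v : V, chi (A v) z = chi (A v) z' :=
  fun h hdeg c hinj hodd hsurj _ hγ hpos _ _ hz hz' v => h.bad_agree hdeg c hinj hodd hsurj hγ hpos hz hz' v

end

end Summit.PneNP.PneNP.Theorems.XorDoor.PC
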